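import Summits.CriticalPhenomena.CardyFormulaZ2.Theses.CardySelfRefinement
import Summits.CriticalPhenomena.CardyFormulaZ2.Theorems.CardySelfRefinementSymmetryUpgradeROfConjecture
import Summits.CriticalPhenomena.CardyFormulaZ2.Theorems.CardySelfRefinementSymmetryUpgradeRZhouDefs
import Summits.CriticalPhenomena.CardyFormulaZ2.Theorems.CardySelfRefinementSymmetryUpgradeRHalfCR
import Literature.Barriers.CriticalPhenomena.FKParafermionicHalfCauchyRiemann
import Literature.Probability.LatticeModels.DartPhase
import Literature.Probability.LatticeModels.InnerFacesHoleFree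
import Literature.Probability.Percolation.InterfaceScalingLimitDiscretised
import Literature.Probability.RandomPlanarGeometry.RectangleConformalMap
import HarnessLib

/-!
# Line skeleton `zhou-rotation-split-audit` for crux `SymmetryUpgradeR` (stmt-CriticalPhenomena-17239,
# route `CardySelfRefinement`) — revision 2 (lead prover-line-stmt-CriticalPhenomena-17239-a1-0, 2026-08-17)

## Revision 2 — the lead's reshape (L4), relative to the planner's opening revision

* **Hole-freeness inserted (S1, S2).** `HalfCR` and `RotationSplit` quantified over ALL finite
  admissible discrete Dobrushin data; the tree already PROVES the `q = 1`, `σ = 1/3` vertex relation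
  for this very observable (`Theorems/CardySusyWardParafermionFamiliesToSLESixHalfCRVertexRelation.lean`,
  `S2.halfCRVertexRelation_of_holeFree`, `χ = i` in the barrier file's clockwise table) under the
  hypothesis that the inner faces of `E` are hole-free, and records there (exact enumeration of the
  `2¹⁷` configurations of an admissible ANNULAR datum) that the relation fails for both `χ = ± i`
  without it.  So `stub_halfCR` was false as typed and is repaired by the hypothesis
  `HoleFree {f | E.IsInnerFace f}` (discharged on every discretisation of a Dobrushin = Jordan domain
  by `holeFree_innerFaces`, which is all the line ever consumes); `RotationSplit` gets the same
  hypothesis (Zhou's split is a statement about simply connected domains; (97) for `F_i` leans on S1).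
* **No re-declared notion (S1).** The planner's `edgePassage γ δ σ e` is LITERALLY the tree's
  `dartPhaseSum γ δ σ e` (`Literature/Probability/LatticeModels/DartPhase.lean`, same body over
  `Polyline.winding = winding`), so the edge observable is `edgeObs E e := bondDartObservable E E.δ (1/3) e`
  (= `cornerObs E E.δ e.1 e.2`, `cornerObs_eq_bondDartObservable`).  The registered signature of
  `stub_halfCR` is spelled in tree vocabulary only (the body of `HalfCR`, unfolded), so that its
  helper file lands before the line's `Defs` module is reviewed; `HalfCR c` is definitionally that text.
* Signatures of S3, S4, S5 unchanged; composition unchanged.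

Idea card `Cruxes/SymmetryUpgradeR/Ideas/zhou-rotation-split-audit.md` (triage r1-1 pass, r1-2 fail,
r1-3 pass — escalation panelist): reach the crux through clause (iv) ALONE by auditing the one
load-bearing finite claim of W. Zhou, *SLE₆ and 2-d critical bond percolation on the square lattice*
(arXiv:2409.03235 v6, 115 pp., unrefereed): Smirnov's `q = 1` EDGE parafermionic observable
`F(e) = E[e^{iW(e,e_b)/3} 1_{e ∈ γ}]` of the bond-`ℤ²` exploration path splits, medial vertex by medial
vertex, as `F = F̃ + F_i` (his (81)–(82), built from local reflection–flip bijections around the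
vertex, Props. 3.2/3.6) where BOTH parts satisfy the exact vertex relation
`F(A) − F(C) = i (F(B) − F(D))` (his (2)/(95)/(97) = Duminil-Copin 2012 Prop. 4, the tree's
`HalfCRRelationAt`) and, in addition, the MISSING opposite-pairs relation
`F̃(A) + F̃(C) = F̃(B) + F̃(D) + O((δ/d_v)^2)` (96), the anti-relation
`F_i(A) + F_i(C) = −(F_i(B) + F_i(D)) + O((δ/d_v)^2)` (98) and the two-endpoint consistency
`F̃(A) = F̃(B_w) + O((δ/d_v)^{2−ε})` (93); after which discrete harmonic analysis under his boundary
"Condition C" (§5, using the half-plane one-arm input (10) = Ikhlef–Ponsaing) and the martingale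
method (§6) are claimed to give `δ^{-1/3} F → (Φ′)^{1/3}` (Thm 1) and interface `→` SLE₆ (Thm 2).

## Shape (5 registered stubs, sorries ONLY there; composition sorry-free)

* `stub_halfCR` (S after rev 2; was M–L) — DC2012 Prop. 4 / Zhou (2) for the tree's encoding: for SOME
  `c ∈ {i, −i}` (fixing the orientation conventions once) the edge observable `edgeObs E` of every
  finite admissible discrete Dobrushin datum WITH HOLE-FREE INNER FACES satisfies `HalfCRRelationAt c`
  at every interior medial vertex (from the landed `S2.halfCRVertexRelation_of_holeFree`, `c = i`).
* `stub_rotationSplit` (XL, THE BET; Zhou §3–§4: Props. 3.2, 3.6, 4.1, Lemma 4.2, Prop. 4.3) —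
  typed NECESSARY CONSEQUENCE of (93), (95), (96), (98): for some exponent `θ > 5/3` and a universal
  `K`, every finite admissible datum carries per-vertex edge values `Ft p k` with (95) exact and the
  three defects `≤ K (δ/d)^θ`, `d` = distance of the medial vertex to the discrete boundary.  Zhou
  states `θ = 2 − ε`; `5/3` is the threshold §5 actually consumes (triage r1-3, pp. 75/79/81) and it
  lies BELOW the Monte-Carlo effective exponents `1.7–1.85` measured for the bijection's necessary
  condition (★) (ZhouProp32Test.md / ZhouProp32Replication.md, kit j023538/9, j023925/6, j023991/2).
* `stub_halfPlaneOneArm` (named input; Zhou's (10), [IkPon12]) — two-sided `n^{-1/3}` bounds for the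
  half-plane one-arm probability of bond-`ℤ²` (event of `CardyBoundaryCoulombGas.HalfPlaneOneArmThird`,
  stmt-5662, and of the sibling stub `stub_halfPlaneOneArmLower` of crux 10814; in tree the route to
  it is the named fact `IkhlefPonsaingFirstPassage` + RSW quasi-multiplicativity).
* `stub_zhouBackEnd` (XL; Zhou §5–§6 = Thm 1 + Lemma 6.1 + Prop. 6.2 + proof of Thm 2) — from the
  vertex relation, the split, and (10): on every CORNER-MARKED RECTILINEAR Dobrushin polygon (the
  tree-admissible domains whose canonical discretisations `meshDomain D δ` satisfy Condition C when
  the discrete marks sit at the corners) SOME admissible family has interfaces converging to SLE₆.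
* `stub_allDomainsOfZhouClass` (L–XL; NOT in Zhou — RSW technology) — one convergent admissible
  family per corner-marked rectilinear polygon ⇒ Smirnov's Conjecture 4 for ALL Dobrushin domains and
  ALL admissible families (`Literature.Probability.Percolation.SLE6LimitZ2AllDiscretisations`):
  insensitivity to `o(1)` displacement of discrete marks/arcs (RSW at the marks), Radó approximation
  of a Jordan domain by corner-marked rectilinear polygons, collar coupling (no long dual/primal path
  in a thin collar; near-boundary islands cost a half-plane 3-arm event, exponent 2 universal = Zhou's
  (9)), continuity of the SLE₆ law.  Same content as the sibling's registered
  `stub_allDomainsOfRectilinear` (crux 10814) up to rendering; one proof serves both.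

Composition: `SymmetryUpgradeR_of : S1 → S2 → S3 → S4 → S5 → SymmetryUpgradeR` (arrow form, no
sorry) ends in the LANDED sandwich `symmetryUpgradeR_of_sle6LimitZ2AllDiscretisations`
(Theorems/CardySelfRefinementSymmetryUpgradeROfConjecture.lean): a family pinned by clause (iv) is,
on every admissibly discretised domain, the weak limit of laws converging to THE SLE₆ law.
`SymmetryUpgradeR_proof` instantiates it with the five stubs (its `sorryAx` closure = the stubs).

## Disproof used (`Cruxes/SymmetryUpgradeR/Disproof.lean`, cycle 1; `Negative/LoadBearing.lean` p133795)

* `symmetryUpgradeR_false_without_clauseIV` (F1): ANY proof must use (iv).  Honoured: (iv) is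
  consumed — and is the ONLY hypothesis of the crux consumed — inside the landed sandwich at the
  last step of `SymmetryUpgradeR_of`; axioms (i) (beyond `P D` a probability law), (ii), (iii) idle.
* F2/F3 (`pinned_of_isSeqLimitAlong`, `not_symmetryUpgradeR_iff`): with (iv) present the crux is the
  identification of the pinned bond-`ℤ²` limit; this line identifies it on the LATTICE side (no
  typed-Markov/Schramm step — `typedSchrammPrinciple_fails`, Negative/TiltedRayFamily.lean, does not
  bite: no stub mentions `ChordalFamily` axioms at all).
* F5 junk audit: every lattice statement below keeps admissibility + positive mesh + finiteness;
  the medial vertices quantified are `halfCREquations E` (genuine interior EDGES — not all of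
  `Sym2 (Site 2)`, the trap that made `CardySusyWard.ParafermionPrecompact` collapse, 11293 note).
* No `stub-false`/Negative lemma of this crux concerns lattice observables; the negatives index
  (11 statements, 2026-08-17) has no statement equal or near any stub.

## Triage answers (acted on)

* r1-3 (1): split typed with the §5-consumed exponent (`θ > 5/3`, not `K/d²`), consistency (93) kept as a clause.
* r1-1 (2) / r1-3 (5): conclusion typed for corner-marked RECTILINEAR polygons; the patch is an explicit stub.
* r1-3 (3): eq. (10) carried as its own named stub (two-sided form Zhou uses in Lemma 5.9 / (135)).
* r1-2 / r1-3 (4): the back end is ONE audit stub of Zhou §5–§6 (not "standard DCS"); its docstring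
  names the seam for a later glued split (Thm 1 | Lemma 6.1 + Prop 6.2).
* r1-1 (3): definition request for Zhou's specific `F̃` (81) filed with the line (see card); the
  back-end stub is stated for ANY split with the recorded interior properties — STRONGER than what
  Zhou proves (his §5 uses boundary behaviour of his `F̃`, Prop. 5.7, (128)–(131)); first prover task
  on S4 is to extract that boundary clause and, if needed, the lead reshapes S2/S4 together.
-/

noncomputable section

namespace Summit.CriticalPhenomena.CardyFormulaZ2.Cruxes.SymmetryUpgradeR.ZhouRotationSplitAudit

open MeasureTheory Filter Set Metric
open Literature.Probability.RandomPlanarGeometry Literature.Probability.LatticeModels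
open Literature.Probability.Percolation (BondConfig bondPercolation half openConnIn)
open Literature.Barriers.CriticalPhenomena (medialCornersAt medialVertexOf HalfCRRelationAt halfCREquations)

/-! ### §0 Vocabulary — LANDED as `Theorems/CardySelfRefinementSymmetryUpgradeRZhouDefs.lean` (p153813):
`edgeObs`, `bdist`, `HalfCR`, `RotationSplit`, `halfBoxArm`, `HalfPlaneOneArm`, `IsRectilinear`,
`IsCornerMark`, `SLESixOnZhouClass` (and the glue `halfCR_iff`); opened here so that every signature
below reads verbatim as registered. -/

open Summit.CriticalPhenomena.CardyFormulaZ2.Theorems.SymmetryUpgradeR.ZhouRotationSplitAudit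

/-! ### §1 The registered stubs (sorries live ONLY here) -/

/-- Registered stub `stub_halfCR` (S1 · CLOSED — landed as `Theorems/CardySelfRefinementSymmetryUpgradeRHalfCR.lean`, p154491).  Duminil-Copin 2012 Prop. 4 /
DCS 2012 Prop. 8.6 at `q = 1` / Zhou (2), for the tree's medial exploration (`medialExploration`, H21
boundary rendering) and the edge observable `edgeObs E = bondDartObservable E E.δ (1/3)`: for some
`c ∈ {i, −i}` the vertex relation holds at every interior medial vertex of every finite admissible
datum with hole-free inner faces.  The signature is `∃ c ∈ {i, −i}, HalfCR c` with `HalfCR` UNFOLDED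
(tree vocabulary only, so the helper file needs no `Defs` import).  Proof route: `c = i`; for
`p ∈ halfCREquations E` (edge of `Ω_δ` off both arcs) either both faces of the edge are inner — then
`S2.halfCRVertexRelation_of_holeFree` (via `cornerObs_eq_bondDartObservable`) — or both are non-inner
(an inner/non-inner pair would make the edge a face-boundary edge, putting its endpoints on
`zdBoundary ⊆ arcs`), and then all four corner values vanish (the exploration steps through inner
faces only, `IsMedialExploration.step`).  It fixes the convention `c` used by S2 and S4. -/
theorem stub_halfCR : ∃ c : ℂ, (c = Complex.I ∨ c = -Complex.I) ∧
    ∀ E : DiscreteDobrushin, E.IsZdAdmissible → HoleFree {f : Site 2 | E.IsInnerFace f} → 0 < E.δ →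
      (meshDomain E.Ω E.δ).Finite → ∀ p ∈ halfCREquations E,
        HalfCRRelationAt c (fun e : Site 2 × Site 2 => bondDartObservable E E.δ (1 / 3) e) p :=
  Summit.CriticalPhenomena.CardyFormulaZ2.Theorems.SymmetryUpgradeR.ZhouRotationSplitAudit.stub_halfCR

/-- Registered stub `stub_rotationSplit` (S2 · THE BET, XL; Zhou arXiv:2409.03235 v6 §3–§4:
Prop. 3.2 p. 38, Prop. 3.6 p. 50, definitions (78)–(82) pp. 51–52, Prop. 4.1, Lemma 4.2, Prop. 4.3
(93)–(98) p. 55).  Given the vertex relation with coefficient `c`, there are an exponent `θ > 5/3`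
and a universal constant `K` such that every finite admissible datum admits a per-vertex split
`RotationSplit c θ K`.  Zhou's construction gives `θ = 2 − ε` via the local reflection–flip
bijections `f_v, f_{j,v}, f̄_v` (one-to-one off an exceptional event of probability `⪯ (δ/d_v)²`,
5-arm scale, his (6)); `θ > 5/3` is the threshold §5 consumes (triage r1-3).  WHY IT MIGHT FAIL:
the bijection's necessary condition (★) `|P(single visit, E_v open) − P(single visit, E_v closed)|
⪯ (δ/d_v)²` shows effective exponents `1.62 → 1.85` rising over `N = 16…512` without a plateau (two
independent codes, ZhouProp32Test.md / ZhouProp32Replication.md): consistent with `> 5/3`, not yet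
with `2`.  CHEAPEST FALSIFIER of the TYPED statement (no transcription of Zhou's classes): `Ft` is a
solution of a finite LINEAR feasibility problem given `F` — estimate `F` on all corners of an `N × N`
Dobrushin square (MC, both codes have the path) and minimise the largest normalised defect over `Ft`
subject to (95); the optimal `K_N(θ)` must stay bounded in `N`.  Trivialiser to exclude first: if the
RAW opposite-pairs defect `Q = F(NW)+F(SE)−F(NE)−F(SW)` already decays faster than `(δ/d)^{5/3}`
(r1-3 measured `≈ (δ/d)^{1.53}` over `N ≤ 512`), `Ft := F` works and the split is idle. -/
theorem stub_rotationSplit :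
    ∀ c : ℂ, (c = Complex.I ∨ c = -Complex.I) → HalfCR c →
      ∃ θ : ℝ, 5 / 3 < θ ∧ ∃ K : ℝ, RotationSplit c θ K := by
  sorry

/-- Registered stub `stub_halfPlaneOneArm` (S3 · NAMED INPUT, Zhou's (10); open in tree).  Two-sided
`n^{-1/3}` bounds for the half-plane one-arm probability of critical bond percolation on `ℤ²`
(Ikhlef–Ponsaing 2012 via the qKZ first-passage identity = tree fact `IkhlefPonsaingFirstPassage`,
stmt-11387, numerically certified for strip widths `m ≤ 4`; plus the strip → half-box conversion by
RSW quasi-multiplicativity, `HalfPlaneOneArmQuasiMultiplicativity.lean`).  Load-bearing in Zhou §5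
(Lemma 5.9, (135): `∫_{L_j} |δ^{-1/3} F| ⪯ δ^{2/3} Σ j^{-1/3} ⪯ 1`) and §6 (Lemma 6.1).  Shared in
content with `CardyBoundaryCoulombGas.HalfPlaneOneArmThird` (log form, stmt-5662) and the sibling
crux's `stub_halfPlaneOneArmLower` (lower half). -/
theorem stub_halfPlaneOneArm : HalfPlaneOneArm := by
  sorry

/-- Registered stub `stub_zhouBackEnd` (S4 · Zhou §5–§6, XL — the AUDIT of pp. 56–106).  From the
vertex relation (S1's `c`), a rotation split with `θ > 5/3` (S2) and the half-plane one-arm input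
(S3): SLE₆ convergence along SOME admissible family of every corner-marked rectilinear Dobrushin
polygon.  Internal seam for a later glued split (tenure): (a) Thm 1 — `δ^{-1/3} c_δ^{-1/3} F(v) →
(Φ′)^{1/3}` uniformly on compacts for Condition-C families (§5: inner domain at height `δ^{1/2+ε}`,
boundary probabilities Props. 5.1–5.3, the primitive `ℱ = ∫ δ^{-1/3} F` (132) — exact by S1 —,
Lemma 5.9 via S3, near-boundary contour control (128)–(131) of `∫ δ^{-1} F̃³`, discrete harmonic
analysis §5.6–5.8, `δ^{-1/3} F_i → 0`); (b) Lemma 6.1 + Prop. 6.2 + proof of Thm 2 (coarse-grained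
slit domains at distance `100 (log δ⁻¹)⁻¹`, a priori Loewner regularity [DST17]/Aizenman–Burchard,
martingale contour at distance `δ^{1/3}` from `b`).  CAVEAT (recorded for the lead): Zhou proves (a)
for HIS `F̃` of (81), using its boundary behaviour (Prop. 5.7, error (115)); this stub quantifies over
ANY split with S2's interior properties and is therefore stronger than his claim — the first task is
to extract the boundary clause §5 needs and, if it is not derivable for an arbitrary split, reshape
S2/S4 together (definition request `ZhouModifiedParafermion` filed with the line). -/
theorem stub_zhouBackEnd :
    ∀ c : ℂ, (c = Complex.I ∨ c = -Complex.I) → HalfCR c →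
      ∀ θ K : ℝ, 5 / 3 < θ → RotationSplit c θ K → HalfPlaneOneArm → SLESixOnZhouClass := by
  sorry

/-- Registered stub `stub_allDomainsOfZhouClass` (S5 · PATCH, L–XL; RSW technology, not in Zhou).
One SLE₆-convergent admissible family on every corner-marked rectilinear polygon ⇒ Smirnov's
Conjecture 4 at `q = 1` for every Dobrushin domain and every admissible family
(`SLE6LimitZ2AllDiscretisations`, stated over the same `bondInterfaceIn`).  Route: (i) on a fixed
corner-marked polygon, the interface laws of two admissible families are `o(1)`-close (their
discrete arcs/marks differ on `o(1)`-windows; RSW at the marks, wedge 3-arm exponent `> 1`);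
(ii) a Jordan Dobrushin domain is the Radó limit of corner-marked rectilinear polygons from inside
(marks moved to nearby corners); (iii) collar coupling at fixed mesh: discrepancies between the two
explorations need a dual/primal path of diameter `≥ η` inside a collar of width `ε` (probability
`≤ (L/ε) e^{−cη/ε}`) or a macroscopic island within `ε` of the wired arc not attached to it
(half-plane 3 arms, `(L/ε)(ε/η)² → 0`, Zhou's (9)); (iv) the SLE₆ law is continuous under Radó
convergence; tightness (Aizenman–Burchard) throughout.  Same content as the sibling's
`stub_allDomainsOfRectilinear` (crux 10814) plus step (i). -/
theorem stub_allDomainsOfZhouClass :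
    SLESixOnZhouClass → Literature.Probability.Percolation.SLE6LimitZ2AllDiscretisations := by
  sorry

/-! ### §2 Composition (sorry-free) -/

/-- **THE SKELETON THEOREM (arrow form).** The five stub statements imply the crux BY NAME: S1 fixes
the convention `c`, S2 splits, S4 (with S3) gives SLE₆ along one admissible family of every
corner-marked rectilinear polygon, S5 extends to all domains and families, and the LANDED sandwich
`symmetryUpgradeR_of_sle6LimitZ2AllDiscretisations` (clause (iv) pins `P D` to the limit of laws
that converge to THE SLE₆ law) concludes.  No `sorry` here. -/
theorem SymmetryUpgradeR_of :
    (∃ c : ℂ, (c = Complex.I ∨ c = -Complex.I) ∧ HalfCR c) →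
    (∀ c : ℂ, (c = Complex.I ∨ c = -Complex.I) → HalfCR c →
        ∃ θ : ℝ, 5 / 3 < θ ∧ ∃ K : ℝ, RotationSplit c θ K) →
    HalfPlaneOneArm →
    (∀ c : ℂ, (c = Complex.I ∨ c = -Complex.I) → HalfCR c →
        ∀ θ K : ℝ, 5 / 3 < θ → RotationSplit c θ K → HalfPlaneOneArm → SLESixOnZhouClass) →
    (SLESixOnZhouClass → Literature.Probability.Percolation.SLE6LimitZ2AllDiscretisations) →
    Summit.CriticalPhenomena.CardyFormulaZ2.Theses.CardySelfRefinement.SymmetryUpgradeR := by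
  rintro ⟨c, hc, hCR⟩ hsplit harm hback hpatch
  obtain ⟨θ, hθ, K, hS⟩ := hsplit c hc hCR
  exact Theorems.SymmetryUpgradeR.SwallowingSkeleton.symmetryUpgradeR_of_sle6LimitZ2AllDiscretisations
    (hpatch (hback c hc hCR θ K hθ hS harm))

/-- `stub_halfCR` is literally `∃ c ∈ {i, −i}, HalfCR c` (the registered text is `HalfCR` unfolded). -/
theorem halfCR_of_stub :
    (∃ c : ℂ, (c = Complex.I ∨ c = -Complex.I) ∧
      ∀ E : DiscreteDobrushin, E.IsZdAdmissible → HoleFree {f : Site 2 | E.IsInnerFace f} → 0 < E.δ →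
        (meshDomain E.Ω E.δ).Finite → ∀ p ∈ halfCREquations E,
          HalfCRRelationAt c (fun e : Site 2 × Site 2 => bondDartObservable E E.δ (1 / 3) e) p) →
    ∃ c : ℂ, (c = Complex.I ∨ c = -Complex.I) ∧ HalfCR c :=
  fun h => h

/-- The crux BY NAME from the five registered stubs (its `sorryAx` closure is exactly the stubs). -/
theorem SymmetryUpgradeR_proof :
    Summit.CriticalPhenomena.CardyFormulaZ2.Theses.CardySelfRefinement.SymmetryUpgradeR :=
  SymmetryUpgradeR_of (halfCR_of_stub stub_halfCR) stub_rotationSplit stub_halfPlaneOneArm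
    stub_zhouBackEnd stub_allDomainsOfZhouClass

/-! ### §3 Non-vacuity of the Zhou class (sorry-free): the square `(-1,1)²` marked at two corners

`SLESixOnZhouClass` quantifies over convex-corner-marked rectilinear Dobrushin polygons; here is one,
built on the tree's `rectDomain` (boundary = counterclockwise polygon through the corners, marks at
parameters `0` and `1/2`, i.e. at `(-1,-1)` and `(1,1)`), with `IsRectilinear` and both `IsCornerMark`s
PROVED — the definitions compute, and the hypothesis of S5 is not vacuously satisfiable through an
empty class. -/

/-- The open square `(-1, 1)²` marked at the corners `(-1,-1)` (parameter `0`) and `(1,1)`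
(parameter `1/2`) of its counterclockwise boundary polygon. -/
def cornerSquare : DobrushinDomain where
  toJordanDomain := rectDomain 1 1 one_pos one_pos
  mark := ![0, 1 / 2]
  strictMono_mark := by
    refine Fin.strictMono_iff_lt_succ.2 fun i => ?_
    fin_cases i
    simp
  mark_mem := by
    intro i
    fin_cases i <;> simp <;> norm_num

theorem cornerSquare_carrier : cornerSquare.carrier = symRect 1 1 := rfl

theorem cornerSquare_pt_zero : cornerSquare.pt 0 = ⟨-1, -1⟩ := by
  have h := polygonLoop_vertex (l := rectVerts (1 : ℝ) 1) (k := 0) (by simp [rectVerts])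
  simp only [Nat.cast_zero, zero_div] at h
  show polygonLoop (rectVerts (1 : ℝ) 1) ((![0, 1 / 2] : Fin 2 → ℝ) 0) = _
  simpa [rectVerts] using h

theorem cornerSquare_pt_one : cornerSquare.pt 1 = ⟨1, 1⟩ := by
  have h := polygonLoop_vertex (l := rectVerts (1 : ℝ) 1) (k := 2) (by simp [rectVerts])
  have hlen : ((rectVerts (1 : ℝ) 1).length : ℝ) = 4 := by simp [rectVerts]
  rw [hlen, show ((2 : ℕ) : ℝ) / 4 = 1 / 2 by norm_num] at h
  show polygonLoop (rectVerts (1 : ℝ) 1) ((![0, 1 / 2] : Fin 2 → ℝ) 1) = _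
  simpa [rectVerts] using h

theorem isRectilinear_cornerSquare : IsRectilinear cornerSquare := by
  classical
  set l : List ℂ := rectVerts (1 : ℝ) 1 with hl
  have hl0 : l ≠ [] := by simp [hl, rectVerts]
  refine ⟨Finset.univ.image fun k : Fin l.length =>
      (l[(k : ℕ)], l[((k : ℕ) + 1) % l.length]'(Nat.mod_lt _ k.pos)), ?_, ?_⟩
  · intro e he
    simp only [Finset.mem_image, Finset.mem_univ, true_and] at he
    obtain ⟨k, rfl⟩ := he
    have hk : (k : ℕ) < 4 := by simpa [hl, rectVerts] using k.isLt
    have : (k : ℕ) = 0 ∨ (k : ℕ) = 1 ∨ (k : ℕ) = 2 ∨ (k : ℕ) = 3 := by omega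
    rcases this with h | h | h | h <;> simp [hl, rectVerts, h]
  · rw [Finset.set_biUnion_finset_image]
    simp only [Finset.mem_univ, iUnion_true]
    rw [← range_polygonLoop hl0]
    exact (rectDomain 1 1 one_pos one_pos).range_boundary.symm

theorem isCornerMark_cornerSquare_zero : IsCornerMark cornerSquare 0 := by
  refine ⟨1, 1, one_pos, Or.inl rfl, ?_⟩
  rw [cornerSquare_pt_zero, cornerSquare_carrier]
  ext z
  simp only [mem_inter_iff, mem_symRect, mem_ball, mem_setOf_eq, map_one, mul_one,
    Complex.sub_re, Complex.sub_im]
  have hre : |(z - ⟨-1, -1⟩ : ℂ).re| ≤ ‖z - ⟨-1, -1⟩‖ := Complex.abs_re_le_norm _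
  have him : |(z - ⟨-1, -1⟩ : ℂ).im| ≤ ‖z - ⟨-1, -1⟩‖ := Complex.abs_im_le_norm _
  rw [Complex.sub_re] at hre
  rw [Complex.sub_im] at him
  simp only [] at hre him
  rw [dist_eq_norm]
  constructor
  · rintro ⟨⟨⟨h1, h2⟩, h3, h4⟩, hd⟩
    exact ⟨hd, by linarith, by linarith⟩
  · rintro ⟨hd, h1, h2⟩
    have hre' := (abs_le.1 (hre.trans hd.le)).2
    have him' := (abs_le.1 (him.trans hd.le)).2
    exact ⟨⟨⟨by linarith, by linarith⟩, by linarith, by linarith⟩, hd⟩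

theorem isCornerMark_cornerSquare_one : IsCornerMark cornerSquare 1 := by
  refine ⟨1, -1, one_pos, Or.inr (Or.inr (Or.inl rfl)), ?_⟩
  rw [cornerSquare_pt_one, cornerSquare_carrier]
  ext z
  simp only [mem_inter_iff, mem_symRect, mem_ball, mem_setOf_eq, map_neg, map_one, mul_neg,
    mul_one, Complex.neg_re, Complex.neg_im, Complex.sub_re, Complex.sub_im]
  have hre : |(z - ⟨1, 1⟩ : ℂ).re| ≤ ‖z - ⟨1, 1⟩‖ := Complex.abs_re_le_norm _
  have him : |(z - ⟨1, 1⟩ : ℂ).im| ≤ ‖z - ⟨1, 1⟩‖ := Complex.abs_im_le_norm _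
  rw [Complex.sub_re] at hre
  rw [Complex.sub_im] at him
  simp only [] at hre him
  rw [dist_eq_norm]
  constructor
  · rintro ⟨⟨⟨h1, h2⟩, h3, h4⟩, hd⟩
    exact ⟨hd, by linarith, by linarith⟩
  · rintro ⟨hd, h1, h2⟩
    have hre' := (abs_le.1 (hre.trans hd.le)).1
    have him' := (abs_le.1 (him.trans hd.le)).1
    exact ⟨⟨⟨by linarith, by linarith⟩, by linarith, by linarith⟩, hd⟩

/-- **The Zhou class is inhabited** (so S4 is not vacuous and S5 does not silently carry the whole
conjecture): the corner-marked square. -/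
theorem zhouClass_nonempty :
    ∃ D : DobrushinDomain, IsRectilinear D ∧ IsCornerMark D 0 ∧ IsCornerMark D 1 :=
  ⟨cornerSquare, isRectilinear_cornerSquare, isCornerMark_cornerSquare_zero,
    isCornerMark_cornerSquare_one⟩


end Summit.CriticalPhenomena.CardyFormulaZ2.Cruxes.SymmetryUpgradeR.ZhouRotationSplitAudit

end
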